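import Summits.CriticalPhenomena.PercolationContinuityZ3.Theorems.PercNearOneGluingNoHeavyLowerTailQuantitativeBHKPositiveExact
import HarnessLib

/-!
# Open paths around a one-sided vertex set: the path lemma behind the cut-vertex cancellation of the CSH hierarchy

Support file (`--supports stmt-CriticalPhenomena-4575`), prover seat `prim-rate-mine-2` (lane prim-rate, constants-miner (c), BENCH row
M2-R19; `run/shared/lean/prim/prim-rate/prim-rate-mine-2/CANDIDATES.md` §gen-4, PROOFS.md §P17).  No definitions, no named facts, no sorries;
standard axioms.  Pure graph theory.

Setting: a pair set `E` (support graph), a vertex set `L`, a vertex `v ∉ L` and a vertex set `Y` such that every pair of `E` with an endpoint in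
`L` has its other endpoint in `L ∪ {v} ∪ Y` («`L` is attached to the rest only through the cut vertex `v` and through `Y`»).  For `ω ⊆ E`:

* `QuantBHK.reachable_inter_compl_of_support_disjoint` — a walk avoiding `L` uses no pair meeting `L`;
* `QuantBHK.path_far_near` — a simple open path avoiding `Y` that starts outside `L` (i) never meets `L` if it ends outside `L`, and (ii) if it
  ends inside `L`, reaches `v` through pairs NOT meeting `L` and then its endpoint through pairs meeting `L`.
This is the combinatorial input of `QuantBHK.cutVertex_cancellation` (the exact vanishing of the level-`[]` CSH margin of a connection
functional when the observer `o` lies in such an `L`, row M2-R19 of the prim-rate lane).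
[cite: Grimmett1999, §2.2] [cite: VandenbergHaggstromKahn2005, §2.1 (pp. 9–13)]
-/

namespace Summit.CriticalPhenomena.PercolationContinuityZ3.Theorems

open Set Literature.Probability.LatticeModels Literature.Probability.Percolation
open scoped Classical

namespace QuantBHK

universe v

variable {V : Type v}

/-- A walk all of whose vertices lie outside `L` uses no pair meeting `L`. [folklore] -/
theorem reachable_inter_compl_of_support_disjoint {ω : Set (Sym2 V)} {L : Set V} {a c : V} (p : (openGraph ω).Walk a c)
    (hp : ∀ z ∈ p.support, z ∉ L) : (openGraph (ω ∩ {f : Sym2 V | ∃ z ∈ f, z ∈ L}ᶜ)).Reachable a c := by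
  refine reachable_of_walk_edges_subset p fun f hf => ⟨(mem_and_not_isDiag_of_mem_edges p hf).1, ?_⟩
  rintro ⟨z, hz, hzL⟩
  exact hp z (SimpleGraph.Walk.mem_support_of_mem_edges hf hz) hzL

/-- **The path lemma of the cut-vertex cancellation.**  `E`-pairs leaving `L` end in `{v} ∪ Y`; `ω ⊆ E`.  A simple open path avoiding `Y` that
starts outside `L` (i) never meets `L` if it ends outside `L`; (ii) if it ends inside `L`, it reaches `v` through pairs NOT meeting `L` and then its end
through pairs meeting `L`. [folklore] -/
theorem path_far_near {E ω : Set (Sym2 V)} (hωE : ω ⊆ E) {L Y : Set V} {v : V} (hvL : v ∉ L)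
    (hL : ∀ p q : V, s(p, q) ∈ E → p ∈ L → q ∈ L ∨ q = v ∨ q ∈ Y) :
    ∀ {a c : V} (P : (openGraph ω).Walk a c), P.IsPath → (∀ z ∈ P.support, z ∉ Y) → a ∉ L →
      (c ∉ L → ∀ z ∈ P.support, z ∉ L) ∧
      (c ∈ L → (openGraph (ω ∩ {f : Sym2 V | ∃ z ∈ f, z ∈ L}ᶜ)).Reachable a v ∧
        (openGraph (ω ∩ {f : Sym2 V | ∃ z ∈ f, z ∈ L})).Reachable v c) := by
  intro a c P
  induction P with
  | nil =>
    intro _ _ haL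
    refine ⟨fun _ z hz => ?_, fun hcL => absurd hcL haL⟩
    rw [SimpleGraph.Walk.support_nil, List.mem_singleton] at hz
    rw [hz]; exact haL
  | @cons a a₁ c h P' ih =>
    intro hP hY haL
    rw [SimpleGraph.Walk.cons_isPath_iff] at hP
    have hY' : ∀ z ∈ P'.support, z ∉ Y := fun z hz => hY z (by rw [SimpleGraph.Walk.support_cons]; exact List.mem_cons_of_mem _ hz)
    have haY : a ∉ Y := hY a (SimpleGraph.Walk.start_mem_support _)
    have he : s(a, a₁) ∈ ω ∧ a ≠ a₁ := by rw [openGraph, SimpleGraph.fromEdgeSet_adj] at h; exact h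
    by_cases ha₁ : a₁ ∈ L
    · -- the path enters `L` at once: then `a = v` and the rest stays in `L`
      have hav : a = v := by
        have hE : s(a₁, a) ∈ E := by rw [Sym2.eq_swap]; exact hωE he.1
        rcases hL a₁ a hE ha₁ with h1 | h1 | h1
        · exact absurd h1 haL
        · exact h1
        · exact absurd h1 haY
      subst hav
      -- `P'` avoids `v` (simplicity) and `Y`, so `L`-membership is constant along it
      have hK : ∀ p q : V, s(p, q) ∈ ω → p ≠ q → (∀ u ∈ ({z | z = a ∨ z ∈ Y} : Set V), u ∉ s(p, q)) → (p ∈ L ↔ q ∈ L) := by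
        intro p q hpq _ hav
        have hqv : q ≠ a := fun hq => hav a (Or.inl rfl) (hq ▸ Sym2.mem_mk_right p q)
        have hpv : p ≠ a := fun hp' => hav a (Or.inl rfl) (hp' ▸ Sym2.mem_mk_left p q)
        have hqY : q ∉ Y := fun hq => hav q (Or.inr hq) (Sym2.mem_mk_right p q)
        have hpY : p ∉ Y := fun hp' => hav p (Or.inr hp') (Sym2.mem_mk_left p q)
        constructor
        · intro hp'
          rcases hL p q (hωE hpq) hp' with h1 | h1 | h1
          · exact h1
          · exact absurd h1 hqv
          · exact absurd h1 hqY
        · intro hq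
          have hqp : s(q, p) ∈ E := by rw [Sym2.eq_swap]; exact hωE hpq
          rcases hL q p hqp hq with h1 | h1 | h1
          · exact h1
          · exact absurd h1 hpv
          · exact absurd h1 hpY
      have hedges : ∀ f ∈ P'.edges, ∀ u ∈ ({z | z = a ∨ z ∈ Y} : Set V), u ∉ f := by
        rintro f hf u (rfl | huY)
        · exact not_mem_of_mem_edges_of_not_mem_support P' hP.2 f hf
        · intro huf
          exact hY' u (SimpleGraph.Walk.mem_support_of_mem_edges hf huf) huY
      have hall : ∀ z ∈ P'.support, z ∈ L := fun z hz =>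
        (mem_iff_mem_of_walk_avoiding_set (K := L) hK P' hedges z hz).1 ha₁
      refine ⟨fun hcL => absurd (hall c P'.end_mem_support) hcL, fun _ => ⟨SimpleGraph.Reachable.refl _, ?_⟩⟩
      refine reachable_of_walk_edges_subset (SimpleGraph.Walk.cons h P') fun f hf => ?_
      refine ⟨(mem_and_not_isDiag_of_mem_edges _ hf).1, ?_⟩
      rw [SimpleGraph.Walk.edges_cons, List.mem_cons] at hf
      rcases hf with hf | hf
      · exact ⟨a₁, hf ▸ Sym2.mem_mk_right _ _, ha₁⟩
      · have hz := Sym2.out_fst_mem f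
        exact ⟨_, hz, hall _ (SimpleGraph.Walk.mem_support_of_mem_edges hf hz)⟩
    · -- the path stays outside `L` for one more step: induct
      obtain ⟨ih1, ih2⟩ := ih hP.1 hY' ha₁
      refine ⟨fun hcL z hz => ?_, fun hcL => ?_⟩
      · rw [SimpleGraph.Walk.support_cons, List.mem_cons] at hz
        rcases hz with hz | hz
        · rw [hz]; exact haL
        · exact ih1 hcL z hz
      · obtain ⟨hfar, hnear⟩ := ih2 hcL
        refine ⟨SimpleGraph.Reachable.trans (SimpleGraph.Adj.reachable ?_) hfar, hnear⟩
        rw [openGraph, SimpleGraph.fromEdgeSet_adj]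
        refine ⟨⟨he.1, ?_⟩, he.2⟩
        rintro ⟨z, hz, hzL⟩
        rcases Sym2.mem_iff.1 hz with rfl | rfl
        · exact haL hzL
        · exact ha₁ hzL


end QuantBHK

end Summit.CriticalPhenomena.PercolationContinuityZ3.Theorems
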